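import Literature.NumberTheory.Automorphic.CuspidalRepDataOfCuspFormInfChar
import Literature.NumberTheory.Automorphic.AutomorphicRepsGLCuspidalSpectralSupportProofs
import Literature.NumberTheory.Automorphic.HarishChandraGLParameterOfCharacter
import Literature.NumberTheory.Automorphic.AutomorphicFormsProofs
import Literature.NumberTheory.Automorphic.ArchParameterUnique
import Literature.NumberTheory.Automorphic.CentralOneParameterODE
import HarnessLib

/-!
# Every automorphic representation of `GL_n(𝔸_K)` has an infinitesimal character
# (Schur's lemma through `Z(𝔤)`-finiteness; Borel–Jacquet 1979, 4.6; Langlands 1979, Prop. 2)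

Topic `NumberTheory/Automorphic`; theorems only (no definition, no named fact). For an ARBITRARY
automorphic representation datum `π = W / W'` of `GL_n(𝔸_K)` in the Borel–Jacquet model
(`AutomorphicRepData (AutomorphyDatum.gl n K hcpt)`: `W' < W` stable spaces of automorphic forms, `W / W'`
irreducible as a `(𝔤, K_∞) × GL_n(𝔸_K^∞)`-module) the centre `Z(𝔤)` of `U(𝔤𝔩_n(K_∞))` acts on `W / W'` by
scalars:

* `AutomorphicRepData.exists_hasInfinitesimalCharacter_gl` — **`π` has an infinitesimal character** `θ`
  (`AutomorphicRepData.HasInfinitesimalCharacter`);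
* `AutomorphicRepData.exists_hasArchParameter_gl` — hence **`π` has an archimedean (Harish-Chandra)
  parameter** (`AutomorphicRepData.HasArchParameter`; through the proved
  `exists_hasArchParameter_of_hasInfinitesimalCharacter`). This is the EXISTENCE half of the named fact
  `AutomorphicRepData.exists_hasInfinityType` (Clozel 1990, §3.3), for every `n` and every datum; the other
  half (the integral pairing of the exponents at a complex place) is archimedean representation theory and
  is not touched here.

Proof (Schur's lemma for `(𝔤, K_∞) × G(𝔸_f)`-modules, in a form that needs neither admissibility nor
countable dimension). Fix a central word `z` and `λ ∈ ℂ`. The functions `ψ ∈ W` with `z ψ - λ ψ ∈ W'`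
form a STABLE subspace between `W'` and `W`: central words commute with every right translation
(`applyFree_comp_mul_right_gl_of_isCentralWord` — the adjoint group acts trivially on `Z(𝔤)`,
`HarishChandraGLCentreInvariant`) and with the Lie derivatives (`applyFree_lieDeriv_of_isCentralWord`). By
irreducibility it is `W'` or `W`: **if ONE `φ ∈ W ∖ W'` has `z φ - λ φ ∈ W'` then ALL `ψ ∈ W` do**
(`forall_applyFree_sub_smul_mem_of_exists`). Now let `φ₀ ∈ W ∖ W'`; it is an automorphic form, hence
`Z(𝔤)`-finite, so its `Z(𝔤)`-orbit span `V` is a finite-dimensional `z`-stable subspace of `W`; the minimal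
polynomial of `z|_V` splits over `ℂ` and `∏ᵢ (z - λᵢ)` kills `φ₀`; if no `λᵢ` were an eigenvalue modulo
`W'`, each factor would preserve `V ∖ W'` and the product could not kill `φ₀ ∉ W'`
(`exists_forall_applyFree_sub_smul_mem`). The scalar is unique modulo `W'` (`W / W' ≠ 0`) and `z ↦ θ(z)`
is an `ℝ`-algebra homomorphism because `z ↦ T_z` is (`exists_hasInfinitesimalCharacter_gl`).

## References
* A. Borel, H. Jacquet, *Automorphic forms and automorphic representations*, Corvallis 1979, 4.6, §1.6 [BorelJacquet1979].
* R. P. Langlands, *On the notion of an automorphic representation*, Corvallis 1979, Prop. 2 [LanglandsCorvallis1979Notion].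
* A. W. Knapp, D. A. Vogan, *Cohomological Induction and Unitary Representations* (1995), (4.113)–(4.114) [KnappVogan1995].
-/

noncomputable section

open scoped MatrixGroups Matrix Classical Polynomial
open NumberField NumberField.mixedEmbedding IsDedekindDomain UniversalEnvelopingAlgebra

namespace Literature.NumberTheory.Automorphic

namespace AutomorphicRepData

variable {n : ℕ} {K : Type} [Field K] [NumberField K] {hcpt : isCompact_glFiniteIntegralLevel n K}
  (π : AutomorphicRepData (AutomorphyDatum.gl n K hcpt))

/-! ### The action of `U(𝔤)` on `W` and on `W / W'` through words -/

/-- `U(𝔤)` acts on `W / W'` through its action on `W`: `T_u [w] = [u w]`. [folklore] -/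
theorem envelopingAction_lieRep_mkQ (u : UniversalEnvelopingAlgebra ℝ (AutomorphyDatum.gl n K hcpt).arch.lie)
    (w : π.W) :
    envelopingAction π.lieRep u (π.mkQ w) = π.mkQ (lift ℝ π.lieRepW u w) :=
  lift_apply_intertwine π.lieRepW π.lieRep π.mkQ (fun X v => π.lieRep_mkQ X v) u w

/-- The words of `U(𝔤)` preserve `W`: `p w ∈ W` for `w ∈ W` (it is `(lift π.lieRepW p̄) w`).
Borel–Jacquet 1979, 4.6. [cite: BorelJacquet1979, 4.6] -/
theorem applyFree_mem_W (p : FreeAlgebra ℝ (AutomorphyDatum.gl n K hcpt).arch.lie)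
    {φ : (AdelicGroupData.gl n K).Adelic → ℂ} (hφ : φ ∈ π.W) :
    applyFree (AutomorphyDatum.gl n K hcpt).ofArch p φ ∈ π.W := by
  rw [← π.coe_lift_lieRepW_freeToEnveloping p ⟨φ, hφ⟩]
  exact (lift ℝ π.lieRepW (freeToEnveloping _ p) ⟨φ, hφ⟩).2

/-- The words of `U(𝔤)` preserve `W'`: `p w ∈ W'` for `w ∈ W'` (`[p w] = T_p̄ [w] = 0`).
Borel–Jacquet 1979, 4.6. [cite: BorelJacquet1979, 4.6] -/
theorem applyFree_mem_W' (p : FreeAlgebra ℝ (AutomorphyDatum.gl n K hcpt).arch.lie)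
    {φ : (AdelicGroupData.gl n K).Adelic → ℂ} (hφ : φ ∈ π.W') :
    applyFree (AutomorphyDatum.gl n K hcpt).ofArch p φ ∈ π.W' := by
  have hφW : φ ∈ π.W := π.lt.le hφ
  have h0 : π.mkQ ⟨φ, hφW⟩ = 0 := by
    rw [Submodule.mkQ_apply, Submodule.Quotient.mk_eq_zero]
    exact hφ
  have h1 : π.mkQ (lift ℝ π.lieRepW (freeToEnveloping _ p) ⟨φ, hφW⟩) = 0 := by
    rw [← envelopingAction_lieRep_mkQ, h0, map_zero]
  rw [Submodule.mkQ_apply, Submodule.Quotient.mk_eq_zero] at h1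
  have h2 : ((lift ℝ π.lieRepW (freeToEnveloping _ p) ⟨φ, hφW⟩ : π.W) :
      (AdelicGroupData.gl n K).Adelic → ℂ) ∈ π.W' := h1
  rwa [π.coe_lift_lieRepW_freeToEnveloping p ⟨φ, hφW⟩] at h2

set_option maxHeartbeats 400000 in
/-- **Words multiply**: `p (q φ) = (p q) φ` for `φ ∈ W` (through `lift π.lieRepW`, an algebra
homomorphism). Borel–Jacquet 1979, §1.5–1.6. [cite: BorelJacquet1979, §1.5–1.6] -/
theorem applyFree_applyFree_of_mem_W (p q : FreeAlgebra ℝ (AutomorphyDatum.gl n K hcpt).arch.lie)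
    {φ : (AdelicGroupData.gl n K).Adelic → ℂ} (hφ : φ ∈ π.W) :
    applyFree (AutomorphyDatum.gl n K hcpt).ofArch p (applyFree (AutomorphyDatum.gl n K hcpt).ofArch q φ) =
      applyFree (AutomorphyDatum.gl n K hcpt).ofArch (p * q) φ := by
  have hq : applyFree (AutomorphyDatum.gl n K hcpt).ofArch q φ =
      ((lift ℝ π.lieRepW (freeToEnveloping _ q) ⟨φ, hφ⟩ : π.W) : (AdelicGroupData.gl n K).Adelic → ℂ) :=
    (π.coe_lift_lieRepW_freeToEnveloping q ⟨φ, hφ⟩).symm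
  rw [hq, ← π.coe_lift_lieRepW_freeToEnveloping p, ← π.coe_lift_lieRepW_freeToEnveloping (p * q) ⟨φ, hφ⟩,
    map_mul, map_mul, Module.End.mul_apply]

/-- `[p w] = c [w]` in `W / W'` iff `p w - c w ∈ W'`. [folklore] -/
theorem envelopingAction_mkQ_eq_smul_iff (p : FreeAlgebra ℝ (AutomorphyDatum.gl n K hcpt).arch.lie)
    (c : ℂ) (w : π.W) :
    envelopingAction π.lieRep (freeToEnveloping _ p) (π.mkQ w) = c • π.mkQ w ↔
      applyFree (AutomorphyDatum.gl n K hcpt).ofArch p w - c • (w : (AdelicGroupData.gl n K).Adelic → ℂ) ∈ π.W' := by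
  rw [envelopingAction_lieRep_mkQ, ← map_smul, ← sub_eq_zero, ← map_sub, Submodule.mkQ_apply,
    Submodule.Quotient.mk_eq_zero]
  change ((lift ℝ π.lieRepW (freeToEnveloping _ p) w - c • w : π.W) :
    (AdelicGroupData.gl n K).Adelic → ℂ) ∈ π.W' ↔ _
  rw [Submodule.coe_sub, Submodule.coe_smul, π.coe_lift_lieRepW_freeToEnveloping p w]

/-! ### Schur's dichotomy: an eigenvalue modulo `W'` of a central word on ONE form outside `W'` is an
eigenvalue modulo `W'` on all of `W` -/

/-- **Schur's dichotomy for a central word.** Let `p` be a central word and `c ∈ ℂ`. If SOME `φ ∈ W ∖ W'`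
has `p φ - c φ ∈ W'`, then EVERY `ψ ∈ W` has `p ψ - c ψ ∈ W'`: the functions `ψ ∈ W` with
`p ψ - c ψ ∈ W'` form a stable subspace between `W'` and `W` (central words commute with all right
translations, `applyFree_comp_mul_right_gl_of_isCentralWord`, and with the Lie derivatives,
`applyFree_lieDeriv_of_isCentralWord`), which is `W'` or `W` by irreducibility, and it is not `W'`.
Borel–Jacquet 1979, 4.6; Knapp–Vogan 1995, (4.114). [cite: BorelJacquet1979, 4.6] -/
theorem forall_applyFree_sub_smul_mem_of_exists {p : FreeAlgebra ℝ (AutomorphyDatum.gl n K hcpt).arch.lie}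
    (hp : IsCentralWord p) (c : ℂ)
    (hex : ∃ φ ∈ π.W, φ ∉ π.W' ∧
      applyFree (AutomorphyDatum.gl n K hcpt).ofArch p φ - c • φ ∈ π.W') :
    ∀ ψ ∈ π.W, applyFree (AutomorphyDatum.gl n K hcpt).ofArch p ψ - c • ψ ∈ π.W' := by
  classical
  have hsm : ∀ {ψ : (AdelicGroupData.gl n K).Adelic → ℂ}, ψ ∈ π.W →
      IsArchSmooth (AutomorphyDatum.gl n K hcpt).ofArch ψ := fun hψ => π.isArchSmooth_of_mem_W hψ
  -- the subspace `S = {ψ ∈ W | p ψ - c ψ ∈ W'}`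
  let S : Submodule ℂ ((AdelicGroupData.gl n K).Adelic → ℂ) :=
    { carrier := {ψ | ψ ∈ π.W ∧ applyFree (AutomorphyDatum.gl n K hcpt).ofArch p ψ - c • ψ ∈ π.W'}
      zero_mem' := ⟨zero_mem _, by
        rw [applyFree_zero_right, smul_zero, sub_zero]; exact zero_mem _⟩
      add_mem' := fun {a b} ha hb => ⟨add_mem ha.1 hb.1, by
        rw [applyFree_add_right_of_isArchSmooth_lieDeriv (AutomorphyDatum.gl n K hcpt).ofArch
          isArchSmooth_lieDeriv_holds p (hsm ha.1) (hsm hb.1), smul_add, add_sub_add_comm]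
        exact add_mem ha.2 hb.2⟩
      smul_mem' := fun a b hb => ⟨Submodule.smul_mem _ a hb.1, by
        rw [applyFree_smul_right, smul_comm c a, ← smul_sub]
        exact Submodule.smul_mem _ a hb.2⟩ }
  have hSmem : ∀ ψ, ψ ∈ S ↔
      ψ ∈ π.W ∧ applyFree (AutomorphyDatum.gl n K hcpt).ofArch p ψ - c • ψ ∈ π.W' := fun ψ => Iff.rfl
  have hSW : S ≤ π.W := fun ψ hψ => ((hSmem ψ).1 hψ).1
  have hW'S : π.W' ≤ S := fun ψ hψ =>
    (hSmem ψ).2 ⟨π.lt.le hψ, sub_mem (π.applyFree_mem_W' p hψ) (Submodule.smul_mem _ c hψ)⟩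
  -- right translations preserving `W` and `W'` preserve `S` (central words commute with them)
  have hSr : ∀ y : (AdelicGroupData.gl n K).Adelic,
      (∀ ψ ∈ π.W, rightTranslation (AdelicGroupData.gl n K) y ψ ∈ π.W) →
      (∀ ψ ∈ π.W', rightTranslation (AdelicGroupData.gl n K) y ψ ∈ π.W') →
      ∀ ψ ∈ S, rightTranslation (AdelicGroupData.gl n K) y ψ ∈ S := by
    intro y hyW hyW' ψ hψ
    obtain ⟨hψW, hψ'⟩ := (hSmem ψ).1 hψ
    refine (hSmem _).2 ⟨hyW ψ hψW, ?_⟩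
    have hc : applyFree (AutomorphyDatum.gl n K hcpt).ofArch p (rightTranslation (AdelicGroupData.gl n K) y ψ) =
        rightTranslation (AdelicGroupData.gl n K) y (applyFree (AutomorphyDatum.gl n K hcpt).ofArch p ψ) :=
      applyFree_comp_mul_right_gl_of_isCentralWord hp (hsm hψW) y
    rw [hc, ← map_smul, ← map_sub]
    exact hyW' _ hψ'
  have hS : IsStableSubmodule (AutomorphyDatum.gl n K hcpt) S :=
    { le_automorphicForms := hSW.trans π.stable.le_automorphicForms
      finite_stable := fun h hh ψ hψ =>
        hSr h (fun ψ hψ => π.stable.finite_stable h hh hψ) (fun ψ hψ => π.stable'.finite_stable h hh hψ) ψ hψ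
      k_stable := fun k ψ hψ =>
        hSr _ (fun ψ hψ => π.stable.k_stable k hψ) (fun ψ hψ => π.stable'.k_stable k hψ) ψ hψ
      lie_stable := fun X ψ hψ => by
        obtain ⟨hψW, hψ'⟩ := (hSmem ψ).1 hψ
        refine (hSmem _).2 ⟨π.stable.lie_stable X ψ hψW, ?_⟩
        have hAψW : applyFree (AutomorphyDatum.gl n K hcpt).ofArch p ψ ∈ π.W := π.applyFree_mem_W p hψW
        have hc : applyFree (AutomorphyDatum.gl n K hcpt).ofArch p (lieDeriv (AutomorphyDatum.gl n K hcpt).ofArch X ψ) =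
            lieDeriv (AutomorphyDatum.gl n K hcpt).ofArch X (applyFree (AutomorphyDatum.gl n K hcpt).ofArch p ψ) :=
          applyFree_lieDeriv_of_isCentralWord (ι := (AutomorphyDatum.gl n K hcpt).ofArch)
            (archGroupGL_lie n K) (archGroupGL_carrier n K) hp X (hsm hψW)
        have hsub : lieDeriv (AutomorphyDatum.gl n K hcpt).ofArch X
              (applyFree (AutomorphyDatum.gl n K hcpt).ofArch p ψ - c • ψ) =
            lieDeriv (AutomorphyDatum.gl n K hcpt).ofArch X (applyFree (AutomorphyDatum.gl n K hcpt).ofArch p ψ) -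
              c • lieDeriv (AutomorphyDatum.gl n K hcpt).ofArch X ψ := by
          rw [sub_eq_add_neg, ← neg_smul,
            IsArchSmooth.lieDeriv_add _ X (hsm hAψW) (IsArchSmooth.smul _ (-c) (hsm hψW)),
            lieDeriv_smul, neg_smul, ← sub_eq_add_neg]
        rw [hc, ← hsub]
        exact π.stable'.lie_stable X _ hψ' }
  -- irreducibility: `S = W'` (impossible: `φ ∈ S ∖ W'`) or `S = W`
  obtain ⟨φ, hφW, hφW', hφ⟩ := hex
  have hφS : φ ∈ S := (hSmem φ).2 ⟨hφW, hφ⟩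
  rcases π.irreducible S hW'S hSW hS with h | h
  · exact absurd (h ▸ hφS) hφW'
  · intro ψ hψ
    have hψS : ψ ∈ S := h ▸ hψ
    exact ((hSmem ψ).1 hψS).2

/-! ### Existence of an eigenvalue modulo `W'`, through `Z(𝔤)`-finiteness -/

set_option maxHeartbeats 400000 in
-- (the adelic function spaces make `whnf` on the orbit-span operators expensive)
/-- **Every central word has an eigenvalue modulo `W'` on all of `W`.** For a central word `p` there is
`c ∈ ℂ` with `p ψ - c ψ ∈ W'` for every `ψ ∈ W`. Take `φ₀ ∈ W ∖ W'` — an automorphic form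
(`mem_automorphicForms_iff`, the `GL_n` datum is regular), hence `Z(𝔤)`-finite: its `Z(𝔤)`-orbit span `V` is a
finite-dimensional subspace of `W`, stable under `p` (`p (q φ₀) = (p q) φ₀`), on which `p` has a minimal
polynomial; it splits over `ℂ`, so `∏ᵢ (p - λᵢ) φ₀ = 0 ∈ W'`. If no `λᵢ` were an eigenvalue modulo `W'`,
then by the dichotomy `forall_applyFree_sub_smul_mem_of_exists` no element of `V ∖ W'` would be moved into
`W'` by any `p - λᵢ`, and inductively `∏ᵢ (p - λᵢ) φ₀ ∉ W'` — a contradiction. Borel–Jacquet 1979, §1.6 and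
4.6; Langlands 1979, Prop. 2. [cite: BorelJacquet1979, 4.6] -/
theorem exists_forall_applyFree_sub_smul_mem {p : FreeAlgebra ℝ (AutomorphyDatum.gl n K hcpt).arch.lie}
    (hp : IsCentralWord p) :
    ∃ c : ℂ, ∀ ψ ∈ π.W, applyFree (AutomorphyDatum.gl n K hcpt).ofArch p ψ - c • ψ ∈ π.W' := by
  classical
  by_contra hne
  push Not at hne
  -- by the dichotomy, NO `λ` moves an element of `W ∖ W'` into `W'`
  have hinj : ∀ (a : ℂ), ∀ ψ ∈ π.W,
      applyFree (AutomorphyDatum.gl n K hcpt).ofArch p ψ - a • ψ ∈ π.W' → ψ ∈ π.W' := by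
    intro a ψ hψ hmem
    by_contra hψ'
    obtain ⟨ψ₁, hψ₁, hψ₁'⟩ := hne a
    exact hψ₁' (π.forall_applyFree_sub_smul_mem_of_exists hp a ⟨ψ, hψ, hψ', hmem⟩ ψ₁ hψ₁)
  -- `φ₀ ∈ W ∖ W'`, an automorphic form, `Z(𝔤)`-finite
  obtain ⟨φ₀, hφ₀W, hφ₀W'⟩ := SetLike.exists_of_lt π.lt
  have h𝒜 : IsAutomorphicForm (AutomorphyDatum.gl n K hcpt) φ₀ :=
    (mem_automorphicForms_iff_holds (𝒟 := AutomorphyDatum.gl n K hcpt)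
      (AutomorphyDatum.isRegular_gl hcpt).directedOn_finiteLevels φ₀).1 (π.stable.le_automorphicForms hφ₀W)
  haveI hZ : FiniteDimensional ℂ (zOrbitSpan (AutomorphyDatum.gl n K hcpt).ofArch φ₀) := h𝒜.zFinite
  -- the orbit span `V ≤ W`, stable under `p`, containing `φ₀`
  have hVW : zOrbitSpan (AutomorphyDatum.gl n K hcpt).ofArch φ₀ ≤ π.W := by
    refine Submodule.span_le.2 ?_
    rintro _ ⟨q, -, rfl⟩
    exact π.applyFree_mem_W q hφ₀W
  have hVsm : ∀ ψ ∈ zOrbitSpan (AutomorphyDatum.gl n K hcpt).ofArch φ₀,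
      IsArchSmooth (AutomorphyDatum.gl n K hcpt).ofArch ψ := fun ψ hψ => π.isArchSmooth_of_mem_W (hVW hψ)
  have hVp : ∀ ψ ∈ zOrbitSpan (AutomorphyDatum.gl n K hcpt).ofArch φ₀,
      applyFree (AutomorphyDatum.gl n K hcpt).ofArch p ψ ∈ zOrbitSpan (AutomorphyDatum.gl n K hcpt).ofArch φ₀ := by
    intro ψ hψ
    induction hψ using Submodule.span_induction with
    | mem x hx =>
      obtain ⟨q, hq, rfl⟩ := hx
      rw [π.applyFree_applyFree_of_mem_W p q hφ₀W]
      refine Submodule.subset_span ⟨p * q, ?_, rfl⟩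
      change freeToEnveloping _ (p * q) ∈ centerU (AutomorphyDatum.gl n K hcpt).arch
      rw [map_mul]
      exact Subalgebra.mul_mem _ hp hq
    | zero => rw [applyFree_zero_right]; exact zero_mem _
    | add x y hx hy ihx ihy =>
      rw [applyFree_add_right_of_isArchSmooth_lieDeriv (AutomorphyDatum.gl n K hcpt).ofArch
        isArchSmooth_lieDeriv_holds p (hVsm x hx) (hVsm y hy)]
      exact add_mem ihx ihy
    | smul a x hx ihx =>
      rw [applyFree_smul_right]
      exact Submodule.smul_mem _ a ihx
  have hφ₀V : φ₀ ∈ zOrbitSpan (AutomorphyDatum.gl n K hcpt).ofArch φ₀ := by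
    refine Submodule.subset_span ⟨1, ?_, ?_⟩
    · change freeToEnveloping _ 1 ∈ centerU (AutomorphyDatum.gl n K hcpt).arch
      rw [map_one]; exact Subalgebra.one_mem _
    · rw [applyFree_one (ι := (AutomorphyDatum.gl n K hcpt).ofArch) φ₀]
  -- the linear operator `A = p|_V`
  let A : zOrbitSpan (AutomorphyDatum.gl n K hcpt).ofArch φ₀ →ₗ[ℂ] zOrbitSpan (AutomorphyDatum.gl n K hcpt).ofArch φ₀ :=
    { toFun := fun v => ⟨applyFree (AutomorphyDatum.gl n K hcpt).ofArch p v, hVp v v.2⟩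
      map_add' := fun v w => Subtype.ext
        (applyFree_add_right_of_isArchSmooth_lieDeriv (AutomorphyDatum.gl n K hcpt).ofArch
          isArchSmooth_lieDeriv_holds p (hVsm v v.2) (hVsm w w.2))
      map_smul' := fun a v => Subtype.ext
        (applyFree_smul_right (AutomorphyDatum.gl n K hcpt).ofArch p a (v : (AdelicGroupData.gl n K).Adelic → ℂ)) }
  have hA : ∀ v : zOrbitSpan (AutomorphyDatum.gl n K hcpt).ofArch φ₀,
      ((A v : zOrbitSpan (AutomorphyDatum.gl n K hcpt).ofArch φ₀) : (AdelicGroupData.gl n K).Adelic → ℂ) =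
        applyFree (AutomorphyDatum.gl n K hcpt).ofArch p v := fun v => rfl
  have hAcoe : ∀ (a : ℂ) (v : zOrbitSpan (AutomorphyDatum.gl n K hcpt).ofArch φ₀),
      (((A - algebraMap ℂ _ a) v : zOrbitSpan (AutomorphyDatum.gl n K hcpt).ofArch φ₀) :
        (AdelicGroupData.gl n K).Adelic → ℂ) =
        applyFree (AutomorphyDatum.gl n K hcpt).ofArch p v - a • (v : (AdelicGroupData.gl n K).Adelic → ℂ) := by
    intro a v
    rw [LinearMap.sub_apply, Module.algebraMap_end_apply, Submodule.coe_sub, Submodule.coe_smul, hA]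
  -- its minimal polynomial splits and kills `φ₀`
  have hint : IsIntegral ℂ A := Algebra.IsIntegral.isIntegral A
  have hPmonic : (minpoly ℂ A).Monic := minpoly.monic hint
  have hPA : Polynomial.aeval A (minpoly ℂ A) = 0 := minpoly.aeval ℂ A
  -- the roots, as a LIST (the operators `A - λᵢ` live in a non-commutative monoid)
  set L : List ℂ := (minpoly ℂ A).roots.toList with hL
  have hPprod : minpoly ℂ A = (L.map fun a => Polynomial.X - Polynomial.C a).prod := by
    have h := (IsAlgClosed.splits (minpoly ℂ A)).eq_prod_roots_of_monic hPmonic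
    rw [← Multiset.coe_toList (minpoly ℂ A).roots, Multiset.map_coe, Multiset.prod_coe] at h
    exact h
  have haeval : Polynomial.aeval A (minpoly ℂ A) = (L.map fun a => A - algebraMap ℂ _ a).prod := by
    conv_lhs => rw [hPprod]
    rw [map_list_prod, List.map_map]
    congr 1
    refine List.map_congr_left fun a _ => ?_
    simp only [Function.comp_apply, map_sub, Polynomial.aeval_X, Polynomial.aeval_C]
  have hkill : (((L.map fun a => A - algebraMap ℂ _ a).prod ⟨φ₀, hφ₀V⟩ :
      zOrbitSpan (AutomorphyDatum.gl n K hcpt).ofArch φ₀) : (AdelicGroupData.gl n K).Adelic → ℂ) = 0 := by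
    rw [← haeval, hPA, LinearMap.zero_apply, ZeroMemClass.coe_zero]
  -- but a product of factors `p - λᵢ`, none an eigenvalue modulo `W'`, does not move `φ₀` into `W'`
  have key : ∀ (l : List ℂ) (v : zOrbitSpan (AutomorphyDatum.gl n K hcpt).ofArch φ₀),
      (v : (AdelicGroupData.gl n K).Adelic → ℂ) ∉ π.W' →
      (((l.map fun a => A - algebraMap ℂ _ a).prod v : zOrbitSpan (AutomorphyDatum.gl n K hcpt).ofArch φ₀) :
        (AdelicGroupData.gl n K).Adelic → ℂ) ∉ π.W' := by
    intro l
    induction l with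
    | nil =>
      intro v hv
      rwa [List.map_nil, List.prod_nil, Module.End.one_apply]
    | cons a l ih =>
      intro v hv hmem
      rw [List.map_cons, List.prod_cons, Module.End.mul_apply, hAcoe] at hmem
      exact ih v hv (hinj a _ (hVW ((l.map fun a => A - algebraMap ℂ _ a).prod v).2) hmem)
  refine key L ⟨φ₀, hφ₀V⟩ hφ₀W' ?_
  rw [hkill]
  exact zero_mem _

/-! ### The infinitesimal character -/

set_option maxHeartbeats 400000 in
set_option synthInstance.maxHeartbeats 80000 in
-- (the adelic function spaces make `whnf` / instance search on `Module.End ℂ (W ⧸ W')` expensive)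
/-- **Every automorphic representation of `GL_n(𝔸_K)` has an infinitesimal character** (Borel–Jacquet
1979, 4.6; Langlands 1979, Prop. 2: `W / W'` is an irreducible `(𝔤, K_∞) × G(𝔸_f)`-module and `Z(𝔤)` acts
on it by scalars). For every datum `π = W / W'` on `GL_n(𝔸_K)` there is an `ℝ`-algebra homomorphism
`θ : Z(𝔤) → ℂ` through which `Z(𝔤)` acts on `W / W'` (`AutomorphicRepData.HasInfinitesimalCharacter`, for
the Lie action `π.lieRep`). The scalar of `exists_forall_applyFree_sub_smul_mem` is unique (`W / W' ≠ 0`)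
and `z ↦ θ(z)` is unital, multiplicative, additive and `ℝ`-linear because `z ↦ T_z` is
(`envelopingAction π.lieRep` is an algebra homomorphism). [cite: BorelJacquet1979, 4.6]
[cite: LanglandsCorvallis1979Notion, Prop. 2] -/
theorem exists_hasInfinitesimalCharacter_gl :
    ∃ θ : centerU (AutomorphyDatum.gl n K hcpt).arch →ₐ[ℝ] ℂ, π.HasInfinitesimalCharacter θ := by
  classical
  -- a non-zero vector of `W / W'`
  obtain ⟨φ₀, hφ₀W, hφ₀W'⟩ := SetLike.exists_of_lt π.lt
  have hq₀ : π.mkQ ⟨φ₀, hφ₀W⟩ ≠ 0 := by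
    intro h0
    rw [Submodule.mkQ_apply, Submodule.Quotient.mk_eq_zero] at h0
    exact hφ₀W' h0
  -- the scalar `θf z` of each central element, and its defining property on `W / W'`
  have hex : ∀ z : centerU (AutomorphyDatum.gl n K hcpt).arch, ∃ c : ℂ,
      ∀ w : π.W, envelopingAction π.lieRep (z : UniversalEnvelopingAlgebra ℝ (AutomorphyDatum.gl n K hcpt).arch.lie)
        (π.mkQ w) = c • π.mkQ w := by
    intro z
    obtain ⟨p, hp⟩ := freeToEnveloping_surjective (AutomorphyDatum.gl n K hcpt).arch
      (z : UniversalEnvelopingAlgebra ℝ (AutomorphyDatum.gl n K hcpt).arch.lie)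
    have hpc : IsCentralWord p := by
      change freeToEnveloping _ p ∈ centerU (AutomorphyDatum.gl n K hcpt).arch
      rw [hp]; exact z.2
    obtain ⟨c, hc⟩ := π.exists_forall_applyFree_sub_smul_mem hpc
    refine ⟨c, fun w => ?_⟩
    rw [← hp, envelopingAction_mkQ_eq_smul_iff]
    exact hc w w.2
  choose θf hθf using hex
  -- uniqueness of scalars: test on the non-zero vector `[φ₀]`
  have huniq : ∀ a b : ℂ, a • π.mkQ ⟨φ₀, hφ₀W⟩ = b • π.mkQ ⟨φ₀, hφ₀W⟩ → a = b := by
    intro a b h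
    rw [← sub_eq_zero, ← sub_smul, smul_eq_zero] at h
    exact sub_eq_zero.1 (h.resolve_right hq₀)
  -- `T` is an algebra homomorphism, so `θf` is one
  have h1 : θf 1 = 1 := by
    refine huniq _ _ ?_
    rw [← hθf, Subalgebra.coe_one, map_one, Module.End.one_apply, one_smul]
  have hmul : ∀ z z', θf (z * z') = θf z * θf z' := by
    intro z z'
    refine huniq _ _ ?_
    rw [← hθf, Subalgebra.coe_mul, map_mul, Module.End.mul_apply, hθf, map_smul, hθf, smul_smul, mul_comm]
  have h0 : θf 0 = 0 := by
    refine huniq _ _ ?_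
    rw [← hθf, ZeroMemClass.coe_zero, map_zero, LinearMap.zero_apply, zero_smul]
  have hadd : ∀ z z', θf (z + z') = θf z + θf z' := by
    intro z z'
    refine huniq _ _ ?_
    rw [← hθf, Subalgebra.coe_add, map_add, LinearMap.add_apply, hθf, hθf, add_smul]
  have hcomm : ∀ r : ℝ, θf (algebraMap ℝ _ r) = algebraMap ℝ ℂ r := by
    intro r
    refine huniq _ _ ?_
    rw [← hθf, Subalgebra.coe_algebraMap, AlgHom.commutes, Module.algebraMap_end_apply,
      Complex.coe_algebraMap, Complex.coe_smul]
  let θ : centerU (AutomorphyDatum.gl n K hcpt).arch →ₐ[ℝ] ℂ :=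
    { toFun := θf
      map_one' := h1
      map_mul' := hmul
      map_zero' := h0
      map_add' := hadd
      commutes' := hcomm }
  refine ⟨θ, π.lieRep, π.hasLieAction_lieRep, fun z => ?_⟩
  refine LinearMap.ext fun q => ?_
  obtain ⟨w, rfl⟩ := π.kerQuot.mkQ_surjective q
  rw [Module.algebraMap_end_apply]
  exact hθf z w

/-- **Every automorphic representation of `GL_n(𝔸_K)` has an archimedean (Harish-Chandra) parameter**:
the infinitesimal character of `exists_hasInfinitesimalCharacter_gl`, restricted to the centres of the
place factors, is a point evaluation of Harish-Chandra's homomorphism (the proved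
`exists_hasArchParameter_of_hasInfinitesimalCharacter`). This is the existence half of the named fact
`AutomorphicRepData.exists_hasInfinityType` (which asks in addition for an integral pairing of the
exponents at the complex places). Clozel 1990, §3.3; Borel–Jacquet 1979, 4.6; Knapp 2002, Thm. 5.44.
[cite: Clozel1990, §3.3] [cite: BorelJacquet1979, 4.6] -/
theorem exists_hasArchParameter_gl : ∃ χ : (K →+* ℂ) → Multiset ℂ, π.HasArchParameter χ := by
  obtain ⟨θ, hθ⟩ := π.exists_hasInfinitesimalCharacter_gl
  exact π.exists_hasArchParameter_of_hasInfinitesimalCharacter hθ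

end AutomorphicRepData

end Literature.NumberTheory.Automorphic

end
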